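import Summits.ResolutionOfSingularities.ResolutionOfSingularities.Theorems.RadicialJungCleanModelsCcurvePersistConormal
import Summits.ResolutionOfSingularities.ResolutionOfSingularities.Theorems.RadicialJungCleanModelsCleanLU3ArcPackage
import Literature.AlgebraicGeometry.Resolution.QuadraticTransforms
import Literature.AlgebraicGeometry.Resolution.ValuationOverrings
import HarnessLib

/-!
# Route `RadicialJung`, crux `CleanModels` (stmt-15917) — (C-curve) sub-line, `curveRegularize` (classical route) I: quadratic transforms along `O` stay inside `locAtCentre B O₁`

Lead `res-B-lead-1` g7 (workfile `Lines/Sketch_Ccurve_assembly.lean` v2.9, S3-core `stub_Cc_curveRegularize`; classical, F-32-free route).  OURS · counted 0.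
Nothing here proves resolution in characteristic `p`; resolution in char `p` is NOT proved.

For `B ⊆ O`, a coarsening `O ≤ O₁` and `R₁ = locAtCentre B O₁` (the local ring at the centre CURVE of `O₁`): a quadratic transform `T → T′` along `O` of a
subring `B ⊆ T ⊆ R₁` containing an element of `B` which is a non-unit for `O` but a unit for `O₁` stays inside `R₁` (`quadraticTransform_le_coarse`): the
generator `u₀` of maximal `O`-value of `𝔪_T` is then an `O₁`-unit, so the chart `T[𝔪_T/u₀]` lies in `R₁`.  Hence the whole quadratic sequence along `O` lies in
`R₁` (`quadraticSeq_le_coarse`), and the local ring at the centre of `O₁` is unchanged along it (`locAtCentre_coarse_eq_of_between`).  The witness exists as soon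
as `dim locAtCentre B O ≠ dim locAtCentre B O₁` (`exists_fine_nonunit_coarse_unit`).
-/

noncomputable section

set_option linter.dupNamespace false

open IsLocalRing Literature.AlgebraicGeometry.Resolution
open Summit.ResolutionOfSingularities.ResolutionOfSingularities.Theorems
open Summit.ResolutionOfSingularities.ResolutionOfSingularities.Theorems.SwitchingDichotomy

namespace Summit.ResolutionOfSingularities.ResolutionOfSingularities.Theorems.RadicialJung.CleanModels.Ccurve

variable {K : Type} [Field K]

/-- An element of `O₁`-value `< 1` lies in (the maximal ideal of) every refinement `O ≤ O₁`. [folklore] -/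
theorem mem_of_valuation_coarse_lt {O O₁ : ValuationSubring K} (hOO₁ : O ≤ O₁) {m : K} (hm : O₁.valuation m < 1) : m ∈ O := by
  by_contra hmO
  have hm0 : m ≠ 0 := by rintro rfl; exact hmO O.zero_mem
  have hinv : m⁻¹ ∈ O := by
    rcases O.mem_or_inv_mem m with h | h
    · exact absurd h hmO
    · exact h
  have h1 : O₁.valuation m⁻¹ ≤ 1 := (O₁.valuation_le_one_iff _).mpr (hOO₁ hinv)
  rw [map_inv₀, inv_le_one₀ ((Valuation.pos_iff _).mpr hm0)] at h1
  exact not_le.mpr hm h1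

/-- `locAtCentre R₁ O ≤ R₁` for `R₁ = locAtCentre B O₁` and `O ≤ O₁`: an `O`-unit of `R₁` is an `O₁`-unit of `R₁`, hence invertible in `R₁`. [folklore] -/
theorem locAtCentre_fine_le {B : Subring K} {O O₁ : ValuationSubring K} (hOO₁ : O ≤ O₁) :
    locAtCentre (locAtCentre B O₁) O ≤ locAtCentre B O₁ := by
  rintro _ ⟨a, ha, b, hb, hvb, rfl⟩
  rw [div_eq_mul_inv]
  exact Subring.mul_mem _ ha (inv_mem_locAtCentre hb (Shannon.valuation_eq_one_of_le hOO₁ hvb))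

/-- If the local rings of `B` at the centres of `O` and of the coarsening `O₁` have different dimensions, some element of `B` is an `O`-non-unit and an `O₁`-unit.
[folklore] -/
theorem exists_fine_nonunit_coarse_unit {B : Subring K} {O O₁ : ValuationSubring K} (hBO : B ≤ O.toSubring) (hOO₁ : O ≤ O₁)
    (hdim : ringKrullDim ↥(locAtCentre B O) ≠ ringKrullDim ↥(locAtCentre B O₁)) :
    ∃ x ∈ B, O.valuation x < 1 ∧ O₁.valuation x = 1 := by
  by_contra h
  push Not at h
  apply hdim
  have heq : locAtCentre B O = locAtCentre B O₁ := by
    refine le_antisymm (le_locAtCentre_coarse hOO₁) ?_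
    rintro _ ⟨a, ha, b, hb, hvb, rfl⟩
    have hvbO : O.valuation b = 1 := by
      rcases ((O.valuation_le_one_iff _).mpr (hBO hb)).lt_or_eq with hlt | heq
      · exact absurd hvb (h b hb hlt)
      · exact heq
    exact ⟨a, ha, b, hb, hvbO, rfl⟩
  rw [heq]

/-- **A quadratic transform along `O` stays inside `R₁ = locAtCentre B O₁`** when its source `T ⊆ R₁` contains an `O`-non-unit `x` which is an `O₁`-unit:
the generator `u₀` of `𝔪_T` of maximal `O`-value is an `O₁`-unit (the `O₁`-non-units of `T` form the prime ideal `subringCentre T O₁ ∌ x`), so `T[𝔪_T/u₀] ⊆ R₁`.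
[folklore] -/
theorem quadraticTransform_le_coarse {B : Subring K} {O O₁ : ValuationSubring K} (hOO₁ : O ≤ O₁)
    {T T' : Subring K} (hTR : T ≤ locAtCentre B O₁) (hqt : IsQuadraticTransformAlong O T T')
    {x : K} (hxT : x ∈ T) (hvx : O.valuation x < 1) (hvx₁ : O₁.valuation x = 1) : T' ≤ locAtCentre B O₁ := by
  classical
  obtain ⟨hloc, hTO, u, u₀, hspan, hu₀, hu₀0, hmax, rfl⟩ := hqt
  haveI := hloc
  have hTO₁ : T ≤ O₁.toSubring := fun w hw => hOO₁ (hTO hw)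
  -- `x ∈ 𝔪_T`
  have hxm : (⟨x, hxT⟩ : ↥T) ∈ maximalIdeal ↥T := by
    rw [IsLocalRing.mem_maximalIdeal, mem_nonunits_iff, isUnit_subring_iff_inv_mem]
    rintro ⟨hx0, hxinv⟩
    have h1 : O.valuation x⁻¹ ≤ 1 := (O.valuation_le_one_iff _).mpr (hTO hxinv)
    rw [map_inv₀, inv_le_one₀ ((Valuation.pos_iff _).mpr hx0)] at h1
    exact not_le.mpr hvx h1
  -- some generator is an `O₁`-unit
  have hgen : ∃ y ∈ u, O₁.valuation ((y : ↥T) : K) = 1 := by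
    by_contra hall
    push Not at hall
    have hsub : (↑u : Set ↥T) ⊆ (subringCentre T O₁ hTO₁ : Set ↥T) := fun y hy =>
      (mem_subringCentre_iff hTO₁ y).mpr (lt_of_le_of_ne ((O₁.valuation_le_one_iff _).mpr (hTO₁ y.2)) (hall y hy))
    have hle : maximalIdeal ↥T ≤ subringCentre T O₁ hTO₁ := by rw [← hspan]; exact Ideal.span_le.mpr hsub
    have : O₁.valuation x < 1 := (mem_subringCentre_iff hTO₁ ⟨x, hxT⟩).mp (hle hxm)
    rw [hvx₁] at this; exact lt_irrefl _ this
  obtain ⟨y, hyu, hvy⟩ := hgen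
  have hvu₀ : O₁.valuation ((u₀ : ↥T) : K) = 1 := by
    apply le_antisymm ((O₁.valuation_le_one_iff _).mpr (hTO₁ u₀.2))
    rw [← hvy]
    exact valuation_le_valuation_of_le hOO₁ (hmax y hyu)
  have hu₀inv : ((u₀ : ↥T) : K)⁻¹ ∈ locAtCentre B O₁ := inv_mem_locAtCentre (hTR u₀.2) hvu₀
  -- the chart lies in `R₁`
  have hcl : Subring.closure ((T : Set K) ∪ (fun x : ↥T => (x : K) / u₀) '' ↑u) ≤ locAtCentre B O₁ := by
    rw [Subring.closure_le]
    rintro w (hw | ⟨y', -, rfl⟩)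
    · exact hTR hw
    · change (y' : K) / u₀ ∈ locAtCentre B O₁
      rw [div_eq_mul_inv]; exact Subring.mul_mem _ (hTR y'.2) hu₀inv
  exact (locAtCentre_mono O hcl).trans (locAtCentre_fine_le hOO₁)

/-- **The quadratic sequence along `O` stays inside `R₁ = locAtCentre B O₁`** (all members contain `B`, and `B` has an `O`-non-unit `O₁`-unit). [folklore] -/
theorem quadraticSeq_le_coarse {B : Subring K} {O O₁ : ValuationSubring K} (hOO₁ : O ≤ O₁)
    (R : ℕ → Subring K) (hB0 : B ≤ R 0) (h0 : R 0 ≤ locAtCentre B O₁) (hstep : ∀ i, IsQuadraticTransformAlong O (R i) (R (i + 1)))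
    {x : K} (hxB : x ∈ B) (hvx : O.valuation x < 1) (hvx₁ : O₁.valuation x = 1) : ∀ i, R i ≤ locAtCentre B O₁ := by
  intro i
  induction i with
  | zero => exact h0
  | succ i ih =>
    exact quadraticTransform_le_coarse hOO₁ ih (hstep i) (sequence_monotone hstep (Nat.zero_le i) (hB0 hxB)) hvx hvx₁

/-- Between `S = locAtCentre B O` and `R₁ = locAtCentre B O₁` the local ring at the centre of `O₁` is `R₁`. [folklore] -/
theorem locAtCentre_coarse_eq_of_between {B T : Subring K} {O O₁ : ValuationSubring K} (hOO₁ : O ≤ O₁)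
    (hST : locAtCentre B O ≤ T) (hTR : T ≤ locAtCentre B O₁) : locAtCentre T O₁ = locAtCentre B O₁ := by
  apply le_antisymm
  · calc locAtCentre T O₁ ≤ locAtCentre (locAtCentre B O₁) O₁ := locAtCentre_mono O₁ hTR
      _ = locAtCentre B O₁ := locAtCentre_locAtCentre B O₁
  · calc locAtCentre B O₁ = locAtCentre (locAtCentre B O) O₁ := (Shannon.locAtCentre_locAtCentre_of_le hOO₁).symm
      _ ≤ locAtCentre T O₁ := locAtCentre_mono O₁ hST

end Summit.ResolutionOfSingularities.ResolutionOfSingularities.Theorems.RadicialJung.CleanModels.Ccurve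

end
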